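import Literature.Computability.QuantumComplexity.Forrelation
import Literature.Computability.QuantumComplexity.ForrelationDirectSum
import Summits.QuantumAdvantage.QuantumAdvantage.Theorems.CubicForrelationNearExactIsExactMmWalsh

/-!
# `NearExactIsExact` (stmt-QuantumAdvantage-14043), line `direct-sum-amplification` — the fibre-family average (FF)

Stub `stub_fibreAverage` of the line `direct-sum-amplification` for the crux
`Summit.QuantumAdvantage.QuantumAdvantage.Theses.CubicForrelation.NearExactIsExact`.

**What.** A FIBRE FAMILY on `s + s + k` bits is a pair `f(a ‖ b ‖ c)`, `g(y′ ‖ u ‖ w)` (`a b y′ u ∈ 𝔽₂^s`,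
`c w ∈ 𝔽₂^k`) in the sign forms

  `(-1)^{f(a ‖ b ‖ c)} = (-1)^{a·b} (-1)^{F_a(c)}`,   `(-1)^{g(y′ ‖ u ‖ w)} = (-1)^{y′·u} (-1)^{G_u(w)}`

for arbitrary families `F, G : 𝔽₂^s → (𝔽₂^k → 𝔽₂)` (no degree hypotheses). Then

  `Φ(f, g) = 2^{-s} ∑_a Φ(F_a, G_a)`      (`stub_fibreAverage`):

the forrelation of the family is the AVERAGE of the forrelations of its fibres.

**Proof.** A pure finite-sum identity. Split both sums of `Φ` into blocks (`sum_append` twice each) and the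
twist accordingly (`twist_append` twice: `(-1)^{x·y} = (-1)^{a·y′} (-1)^{b·u} (-1)^{c·w}`). For fixed
`x = a ‖ b ‖ c` the sum over the linear block `y′` is `∑_{y′} (-1)^{a·y′} (-1)^{y′·u} = 2^s [u = a]`
(`mw_sum_linear_block`), which pins `u = a` (`fa_inner_sum`); then the sum over `b` is
`∑_b (-1)^{a·b} (-1)^{b·a} = 2^s` (`mw_sum_linear_block` again), leaving
`2^s · 2^s · ∑_a ∑_{c,w} (-1)^{F_a(c)} (-1)^{c·w} (-1)^{G_a(w)}` (`fa_fsum`); the normalisation is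
`√(2^{3(s+s+k)}) = 2^s · 2^{2s} · √(2^{3k})` (`sqrt_two_pow_three_mul_add`, `mw_sqrt_two_pow`).

References (orientation only; everything here is proved): S. Aaronson, A. Ambainis, Forrelation, SIAM J. Comput.
47 (2018), §1.1.1 (definition of `Φ`); R. O'Donnell, Analysis of Boolean Functions (2014), §1.4 (orthogonality
of characters); J. F. Dillon, Elementary Hadamard difference sets (1974), Ch. 5 (Maiorana–McFarland fibrations).
-/

set_option linter.dupNamespace false -- D-0017: single-problem summit

namespace Summit.QuantumAdvantage.QuantumAdvantage.Theorems.CubicForrelation.NearExactIsExact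

open Finset
open Literature.Computability.QuantumComplexity

/-- **The dual sum of a fibre family pins the fibre.** If `(-1)^{g(y′ ‖ u ‖ w)} = (-1)^{y′·u} (-1)^{G_u(w)}`,
then for `x = a ‖ b ‖ c` and any scalar `C`,
`∑_y C (-1)^{x·y} (-1)^{g(y)} = 2^s (-1)^{b·a} ∑_w C (-1)^{c·w} (-1)^{G_a(w)}`: the sum over the linear
block `y′` is `2^s [u = a]` (`mw_sum_linear_block`). [folklore] -/
theorem fa_inner_sum {s k : ℕ} (g : (Fin (s + s + k) → Bool) → Bool)
    (G : (Fin s → Bool) → (Fin k → Bool) → Bool)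
    (hg : ∀ (y u : Fin s → Bool) (w : Fin k → Bool),
      signOf (g (Fin.append (Fin.append y u) w)) = twist y u * signOf (G u w))
    (C : ℝ) (a b : Fin s → Bool) (c : Fin k → Bool) :
    ∑ y : Fin (s + s + k) → Bool, C * twist (Fin.append (Fin.append a b) c) y * signOf (g y) =
      (2 : ℝ) ^ s * twist b a * ∑ w : Fin k → Bool, C * twist c w * signOf (G a w) := by
  rw [sum_append (n₁ := s + s) (n₂ := k), sum_append (n₁ := s) (n₂ := s)]
  have e : ∀ (y' u : Fin s → Bool) (w : Fin k → Bool),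
      C * twist (Fin.append (Fin.append a b) c) (Fin.append (Fin.append y' u) w) *
          signOf (g (Fin.append (Fin.append y' u) w)) =
        twist a y' * twist y' u * (twist b u * (C * twist c w * signOf (G u w))) := by
    intro y' u w
    rw [twist_append, twist_append, hg]
    ring
  simp_rw [e]
  rw [Finset.sum_comm]
  have e2 : ∀ u : Fin s → Bool,
      ∑ y' : Fin s → Bool, ∑ w : Fin k → Bool,
          twist a y' * twist y' u * (twist b u * (C * twist c w * signOf (G u w))) =
        if u = a then (2 : ℝ) ^ s * ∑ w : Fin k → Bool, twist b u * (C * twist c w * signOf (G u w))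
        else 0 := by
    intro u
    simp_rw [← mul_sum]
    rw [← sum_mul, mw_sum_linear_block]
    split_ifs <;> simp
  rw [sum_congr rfl fun u _ => e2 u, Finset.sum_ite_eq', if_pos (mem_univ _), mul_sum, mul_sum]
  refine sum_congr rfl fun w _ => ?_
  ring

/-- **The unnormalised forrelation sum of a fibre family**: under the two sign forms,
`∑_{x,y} (-1)^{f(x)} (-1)^{x·y} (-1)^{g(y)} = 2^s · 2^s · ∑_a ∑_c ∑_w (-1)^{F_a(c)} (-1)^{c·w} (-1)^{G_a(w)}`
(`fa_inner_sum` pins `u = a`, then `∑_b (-1)^{a·b} (-1)^{b·a} = 2^s` by `mw_sum_linear_block`). [folklore] -/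
theorem fa_fsum {s k : ℕ} (f g : (Fin (s + s + k) → Bool) → Bool)
    (F G : (Fin s → Bool) → (Fin k → Bool) → Bool)
    (hf : ∀ (a b : Fin s → Bool) (c : Fin k → Bool),
      signOf (f (Fin.append (Fin.append a b) c)) = twist a b * signOf (F a c))
    (hg : ∀ (y u : Fin s → Bool) (w : Fin k → Bool),
      signOf (g (Fin.append (Fin.append y u) w)) = twist y u * signOf (G u w)) :
    ∑ x : Fin (s + s + k) → Bool, ∑ y : Fin (s + s + k) → Bool, signOf (f x) * twist x y * signOf (g y) =
      (2 : ℝ) ^ s * (2 : ℝ) ^ s * ∑ a : Fin s → Bool, ∑ c : Fin k → Bool, ∑ w : Fin k → Bool,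
        signOf (F a c) * twist c w * signOf (G a w) := by
  rw [sum_append (n₁ := s + s) (n₂ := k), sum_append (n₁ := s) (n₂ := s)]
  have e : ∀ (a b : Fin s → Bool) (c : Fin k → Bool),
      ∑ y : Fin (s + s + k) → Bool, signOf (f (Fin.append (Fin.append a b) c)) *
          twist (Fin.append (Fin.append a b) c) y * signOf (g y) =
        twist a b * twist b a *
          ((2 : ℝ) ^ s * ∑ w : Fin k → Bool, signOf (F a c) * twist c w * signOf (G a w)) := by
    intro a b c
    rw [fa_inner_sum g G hg, hf]
    simp only [mul_sum]
    refine sum_congr rfl fun w _ => ?_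
    ring
  simp_rw [e]
  have e2 : ∀ a : Fin s → Bool,
      ∑ b : Fin s → Bool, ∑ c : Fin k → Bool, twist a b * twist b a *
          ((2 : ℝ) ^ s * ∑ w : Fin k → Bool, signOf (F a c) * twist c w * signOf (G a w)) =
        (2 : ℝ) ^ s * (2 : ℝ) ^ s *
          ∑ c : Fin k → Bool, ∑ w : Fin k → Bool, signOf (F a c) * twist c w * signOf (G a w) := by
    intro a
    simp_rw [← mul_sum]
    rw [← sum_mul, mw_sum_linear_block, if_pos rfl]
    simp only [mul_sum]
    refine sum_congr rfl fun c _ => sum_congr rfl fun w _ => ?_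
    ring
  rw [sum_congr rfl fun a _ => e2 a, ← mul_sum]

/-- **The fibre-family average** (stub `stub_fibreAverage`, tag FF, of the line `direct-sum-amplification`).
For `f(a ‖ b ‖ c) = a·b ⊕ F_a(c)` and `g(y′ ‖ u ‖ w) = y′·u ⊕ G_u(w)` on `s + s + k` bits (sign forms as
hypotheses, `F, G` arbitrary), `Φ(f, g) = 2^{-s} ∑_a Φ(F_a, G_a)`: the twist splits over the blocks
(`twist_append`), the character sums `∑_{y′} (-1)^{y′·(a ⊕ u)} = 2^s [u = a]` and `∑_b (-1)^{b·(a ⊕ a)} = 2^s`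
(`mw_sum_linear_block`) give `fa_fsum`, and `√(2^{3(s+s+k)}) = 2^s · 2^{2s} · √(2^{3k})`
(`sqrt_two_pow_three_mul_add`, `mw_sqrt_two_pow`). [folklore] -/
theorem stub_fibreAverage :
    ∀ (s k : ℕ) (f g : (Fin (s + s + k) → Bool) → Bool) (F G : (Fin s → Bool) → (Fin k → Bool) → Bool),
      (∀ (a b : Fin s → Bool) (c : Fin k → Bool),
          signOf (f (Fin.append (Fin.append a b) c)) = twist a b * signOf (F a c)) →
      (∀ (y u : Fin s → Bool) (w : Fin k → Bool),
          signOf (g (Fin.append (Fin.append y u) w)) = twist y u * signOf (G u w)) →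
      forrelation f g = ((2 : ℝ) ^ s)⁻¹ * ∑ a : Fin s → Bool, forrelation (F a) (G a) := by
  intro s k f g F G hf hg
  unfold forrelation
  rw [fa_fsum f g F G hf hg, sqrt_two_pow_three_mul_add (s + s) k, mw_sqrt_two_pow s, ← mul_sum]
  have h2 : (2 : ℝ) ^ s ≠ 0 := by positivity
  have h3 : Real.sqrt ((2 : ℝ) ^ (3 * k)) ≠ 0 := by positivity
  rw [show (2 : ℝ) ^ (2 * s) = (2 : ℝ) ^ s * (2 : ℝ) ^ s by ring]
  field_simp

end Summit.QuantumAdvantage.QuantumAdvantage.Theorems.CubicForrelation.NearExactIsExact
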